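import Summits.QuantumFields.BalabanUV.T4Continuum.Spine.NE1p.TiltedMeanInfluenceModel

/-!
# BalabanUVNodes ∕ node N14 = NE1′ — THE TILT-INCREMENT LEDGER: booking the slot influences by their increments from zero tilt makes
# the OLD budget second order WITH NO CENTRING, all first-order content moving to the base width = zero-tilt matching (LENS card 3,
# integrated form, on gen 4's N-slot decoupled model)

Cell `pub-ymgap`, HUMAN RULING D-0062 (Track A at full width), seat `pub-ymgap-dag-n14-c` (R134 ACCELERATION, strategy s1), generation 3;
route `Summits/QuantumFields/YangMills/Theses/BalabanUVNodes.lean` (cluster K3′ `SpineGivenEndpointR12`, `--supports … --as helper`); venue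
ruling R424 (`YangMills/Theorems`, namespace `YMDAG.N14.TiltIncrement`).  ADDITIVE — imports the gaps-ne1 gen-4 module
`Spine/NE1p/TiltedMeanInfluenceModel` (gaps-ne1 gen 4: `tiltedMean_pi_sum`, `scaleLedger_pi`; hence `TiltedMeanInfluence.abs_tiltedMean_sub_le`,
`sum_sq_amp_le`, `TiltedMeanCrossover.{ScaleLedger, OldInfluenceBudget, YoungInfluenceRate, tiltedMeanMatching_of_budget, summable_crossoverEta}`)
ONLY; theorems only; modifies nothing.

WHAT THIS IS.  The control lens (memo `LENS-control.md` bdbc715bd5c6066f, card 3) reads the residual binder `TiltedMeanMatching` (:253)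
through `d∕ds tiltedMean = tilted variance`.  In INTEGRATED form this says: book each slot's influence by its INCREMENT FROM ZERO TILT,
`Δ X (s) := tiltedMean h_X κ_X s − tiltedMean h_X κ_X 0`.  Then
* §1 `oldInfluenceBudget_of_increments` — the increments are second order UNCONDITIONALLY: `|Δ X (s)| ≤ (amp X)²·|s|` for ANY finite slot
  law (gen 4's `abs_tiltedMean_sub_le`: the tilted mean is `B²`-Lipschitz in the tilt, derivative = tilted variance `≤ B²`), so gen 3's
  `OldInfluenceBudget` holds for the increment data with size `l₀·c₁²` and ratio `θ₁²Λ` from the amplitude ∕ count census ALONE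
  (`oldInfluenceBudget_of_sq_amplitudes'` = the tree's squared-amplitude ledger with the constant `2` removed) — where gen 4's
  `TiltedMeanInfluenceModel.oldInfluenceBudget_pi` needed every slot law to CENTRE its contribution (census R28 (2): conjugation symmetry ×
  flatness) and paid `2·l₀·c₁²`.
* §2 `scaleLedger_pi_increments` — on the N-slot decoupled model (product laws `⊗_X κA K X`, `⊗_X κB K X`, observable `Σ_X h K X`) the
  scale ledger with increment data holds BY CONSTRUCTION with BASE TERMS the zero-tilt totals `tiltedMean (Σ h) (⊗κ) 0`; its base width
  `w K` is exactly the ZERO-TILT (undressed, `t = 0`) first-moment matching of the two runs — the NE7∕NE5-type statement the socket of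
  `…N14VarianceSocket` calls `η₀` (NE1.md R23 (a)).
* §3 **`tiltedMeanMatching_pi_of_zeroTilt`** — hence, with the young rate for the increment data ASSUMED as in gen 4 and NO centring
  anywhere: `TiltedMeanMatching … (crossoverEta vol (l₀c₁²) (l₀c₁²) C (θ₁²Λ) θ Λ′ w)`, summable when `Summable w`, `0 < θ₁²Λ < 1`, `0 < θ < 1`,
  `θ ≤ Λ′` (`summable_crossoverEta_of_zeroTilt`).  WHAT CENTRING WAS BUYING in the census's second-order bookings is thereby isolated on the
  model: nothing in the old budget — only the base width `w = 0`.

WHAT THIS IS NOT.  A PRODUCT-LAW MODEL ([folklore] bookkeeping on the tree's own objects); Bałaban's class-conditioned laws are not product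
laws (decoupling = NODE O's object; under the lens, the engine `CovGradBound` of `…N14CovGradEngine`), and the zero-tilt matching `w` is
another row's content (undressed NE7∕NE5), not supplied here.  Nothing of [Balaban1989LargeFieldII] is asserted; N14 NOT discharged;
count-neutral.  One finite four-torus programme at fixed ε; NOT ℝ⁴, NOT OS, NOT a mass gap, NOT Clay.  0 sorry.
-/

noncomputable section

namespace YMDAG.N14.TiltIncrement

open MeasureTheory ProbabilityTheory Finset
open scoped BigOperators
open Summit.QuantumFields.BalabanUV.T4Continuum.NE1p
open Summit.QuantumFields.BalabanUV.T4Continuum.NE1p.DressedMGFForm (tiltedMean TiltedMeanMatching)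
open Summit.QuantumFields.BalabanUV.T4Continuum.NE1p.TiltedMeanCrossover
  (ScaleLedger OldInfluenceBudget YoungInfluenceRate crossoverEta tiltedMeanMatching_of_budget summable_crossoverEta)
open Summit.QuantumFields.BalabanUV.T4Continuum.NE1p.TiltedMeanInfluence (abs_tiltedMean_sub_le sum_sq_amp_le)
open Summit.QuantumFields.BalabanUV.T4Continuum.NE1p.TiltedMeanInfluenceModel (tiltedMean_pi_sum)

/-! ## §1 Increments from zero tilt are second order unconditionally; the squared-amplitude ledger without the factor `2` -/

section Ledger

variable {ι D : Type*} [DecidableEq ι] {l₀ vol : ℝ} {T : ℕ → Finset ι} {Bad : ℕ → ℝ → Finset ι}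
  {wf : ℕ → ι → Finset D} {sc : ℕ → D → ℕ} {Δ : ℕ → ℝ → ι → ℝ → D → ℝ}

/-- **SQUARED-AMPLITUDE LEDGER, CONSTANT `1`** [folklore].  Per-slot influences `|Δ K t τ s X| ≤ |s|·(amp K X)²` and scale-`j` slice sums of
the squared amplitudes `≤ vol·c·b^{K−j}` give `OldInfluenceBudget l₀ T Bad wf sc Δ vol (l₀·c) b` — the tree's
`TiltedMeanInfluence.oldInfluenceBudget_of_sq_amplitudes` with its hypothesis constant `2` removed. -/
theorem oldInfluenceBudget_of_sq_amplitudes' {amp : ℕ → D → ℝ} {c b : ℝ}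
    (hΔ : ∀ K (t : ℝ), |t| ≤ l₀ → ∀ τ ∈ T K \ Bad K t, ∀ s : ℝ, |s| ≤ l₀ →
      ∀ X ∈ wf K τ, |Δ K t τ s X| ≤ |s| * amp K X ^ 2)
    (hamp : ∀ K (τ : ι), ∀ j ≤ K, ∑ X ∈ wf K τ with sc K X = j, amp K X ^ 2 ≤ vol * (c * b ^ (K - j))) :
    OldInfluenceBudget l₀ T Bad wf sc Δ vol (l₀ * c) b := by
  intro K t ht τ hτ s hs j hj
  have hs0 : 0 ≤ |s| := abs_nonneg s
  calc ∑ X ∈ wf K τ with sc K X = j, |Δ K t τ s X - 0|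
      ≤ ∑ X ∈ wf K τ with sc K X = j, |s| * amp K X ^ 2 :=
        sum_le_sum fun X hX => by rw [sub_zero]; exact hΔ K t ht τ hτ s hs X (mem_filter.mp hX).1
    _ = |s| * ∑ X ∈ wf K τ with sc K X = j, amp K X ^ 2 := by rw [mul_sum]
    _ ≤ l₀ * (vol * (c * b ^ (K - j))) :=
        mul_le_mul hs (hamp K τ j hj) (sum_nonneg fun X _ => sq_nonneg _) ((abs_nonneg s).trans hs)
    _ = vol * (l₀ * c * b ^ (K - j)) := by ring

variable {S : Type*} [MeasurableSpace S] {h : ℕ → D → S → ℝ} {amp : ℕ → D → ℝ}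

/-- **THE OLD BUDGET FOR TILT INCREMENTS HOLDS WITH NO CENTRING** (LENS card 3, integrated form) [folklore].  For ANY finite slot laws
`κ K X`, bounded measurable contributions `|h K X| ≤ amp K X` with `0 ≤ amp K X ≤ c₁·θ₁^{K − sc K X}` and at most `vol·Λ^{K−j}` ledger slots
of scale `j`: the INCREMENT data `Δ K t τ s X := tiltedMean (h K X) (κ K X) s − tiltedMean (h K X) (κ K X) 0` satisfy
`OldInfluenceBudget l₀ T Bad wf sc Δ vol (l₀·c₁²) (θ₁²·Λ)` — by gen 4's `abs_tiltedMean_sub_le` (`|Δ| ≤ amp²·|s|`, the tilted mean being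
`amp²`-Lipschitz in the tilt) and the squared-amplitude ledger.  Compare `TiltedMeanInfluenceModel.oldInfluenceBudget_pi`: centring
hypothesis `∫ h dκ = 0` on every slot, size `2·l₀·c₁²`. -/
theorem oldInfluenceBudget_of_increments {κ : ℕ → D → Measure S} [∀ K X, IsFiniteMeasure (κ K X)] {c₁ θ₁ Λ : ℝ}
    (hmeas : ∀ K X, Measurable (h K X)) (hbound : ∀ K X y, |h K X y| ≤ amp K X)
    (hamp : ∀ K X, 0 ≤ amp K X ∧ amp K X ≤ c₁ * θ₁ ^ (K - sc K X))
    (hcount : ∀ K (τ : ι), ∀ j ≤ K, (((wf K τ).filter fun X => sc K X = j).card : ℝ) ≤ vol * Λ ^ (K - j)) :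
    OldInfluenceBudget l₀ T Bad wf sc
      (fun K _ _ s X => tiltedMean (h K X) (κ K X) s - tiltedMean (h K X) (κ K X) 0) vol (l₀ * c₁ ^ 2) (θ₁ ^ 2 * Λ) := by
  refine oldInfluenceBudget_of_sq_amplitudes' (amp := amp) (fun K t _ τ _ s _ X _ => ?_)
    (fun K τ => sum_sq_amp_le (fun K τ X _ => hamp K X) hcount K τ)
  have hL := abs_tiltedMean_sub_le (ν := κ K X) (hmeas K X) (hbound K X) s 0
  rw [sub_zero] at hL
  linarith [hL]

end Ledger

/-! ## §2 The N-slot decoupled model with increment data: the scale ledger holds by construction, base = zero-tilt totals -/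

section Model

variable {D S : Type*} [Fintype D] [DecidableEq D] [MeasurableSpace S]
  {κA κB : ℕ → D → Measure S} [∀ K X, IsProbabilityMeasure (κA K X)] [∀ K X, IsProbabilityMeasure (κB K X)]
  {h : ℕ → D → S → ℝ} {amp : ℕ → D → ℝ} {sc : ℕ → D → ℕ} {l₀ : ℝ} {w : ℕ → ℝ}

/-- **THE SCALE LEDGER WITH INCREMENT DATA HOLDS BY CONSTRUCTION; ITS BASE WIDTH IS THE ZERO-TILT MATCHING** [folklore].  One class, no
bad classes, all slots in the ledger with scales `sc K X ≤ K`; both runs' tilted means of the total `Σ_X h K X (x X)` under the product laws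
are `(zero-tilt total) + Σ_X (increment of the slot's own tilted mean)` (gen 4's `tiltedMean_pi_sum` at `s` and at `0`), and the base
terms differ by at most `w K` iff the two runs' ZERO-TILT (undressed) first moments do — the socket's `η₀`. -/
theorem scaleLedger_pi_increments (hmeas : ∀ K X, Measurable (h K X)) (hbound : ∀ K X y, |h K X y| ≤ amp K X)
    (hsc : ∀ K X, sc K X ≤ K)
    (hw : ∀ K, |tiltedMean (fun x : D → S => ∑ X, h K X (x X)) (Measure.pi (κB K)) 0
      - tiltedMean (fun x : D → S => ∑ X, h K X (x X)) (Measure.pi (κA K)) 0| ≤ w K) :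
    ScaleLedger (ι := Unit) (Ω := fun _ => D → S) (Ω' := fun _ => D → S) l₀ (fun _ => {()}) (fun _ _ => ∅)
      (fun K x => ∑ X, h K X (x X)) (fun K _ => Measure.pi (κA K))
      (fun K x => ∑ X, h K X (x X)) (fun K _ => Measure.pi (κB K))
      (fun _ _ => univ) sc
      (fun K _ _ _ => tiltedMean (fun x : D → S => ∑ X, h K X (x X)) (Measure.pi (κA K)) 0)
      (fun K _ _ _ => tiltedMean (fun x : D → S => ∑ X, h K X (x X)) (Measure.pi (κB K)) 0)
      (fun K _ _ s X => tiltedMean (h K X) (κA K X) s - tiltedMean (h K X) (κA K X) 0)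
      (fun K _ _ s X => tiltedMean (h K X) (κB K X) s - tiltedMean (h K X) (κB K X) 0) w := by
  intro K t _ τ _ s _
  refine ⟨fun X _ => hsc K X, ?_, ?_, hw K⟩
  · dsimp only
    rw [tiltedMean_pi_sum (κ := κA K) (hmeas K) (hbound K) s, tiltedMean_pi_sum (κ := κA K) (hmeas K) (hbound K) 0,
      sum_sub_distrib, add_sub_cancel]
  · dsimp only
    rw [tiltedMean_pi_sum (κ := κB K) (hmeas K) (hbound K) s, tiltedMean_pi_sum (κ := κB K) (hmeas K) (hbound K) 0,
      sum_sub_distrib, add_sub_cancel]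

/-- **`TiltedMeanMatching` ON THE DECOUPLED MODEL WITH NO CENTRING** (LENS card 3 on gen 4's model) [folklore].  Amplitude ∕ count census
as in gen 4 (`|h K X| ≤ amp K X ≤ c₁·θ₁^{K − sc K X}`, at most `vol·Λ^{K−j}` slots of scale `j`), the young rate ASSUMED for the pair of
INCREMENT families (row NE5∕NE9's content, as in gen 4 — no mechanism offered), and the ZERO-TILT matching `w K` of the two runs' first
moments (undressed NE7∕NE5-type content, the socket's `η₀`): then the two product-law runs satisfy
`TiltedMeanMatching l₀ … (crossoverEta vol (l₀c₁²) (l₀c₁²) C (θ₁²Λ) θ Λ′ w)` — NO centring hypothesis on any slot law (gen 4's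
`tiltedMeanMatching_pi` needed `∫ h K X dκA K X = ∫ h K X dκB K X = 0` for all slots and paid `2l₀c₁²` with `w = 0`). -/
theorem tiltedMeanMatching_pi_of_zeroTilt {vol c₁ θ₁ Λ C θ Λ' : ℝ}
    (hmeas : ∀ K X, Measurable (h K X)) (hbound : ∀ K X y, |h K X y| ≤ amp K X) (hsc : ∀ K X, sc K X ≤ K)
    (hamp : ∀ K X, 0 ≤ amp K X ∧ amp K X ≤ c₁ * θ₁ ^ (K - sc K X))
    (hcount : ∀ K, ∀ j ≤ K, (((univ : Finset D).filter fun X => sc K X = j).card : ℝ) ≤ vol * Λ ^ (K - j))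
    (hw : ∀ K, |tiltedMean (fun x : D → S => ∑ X, h K X (x X)) (Measure.pi (κB K)) 0
      - tiltedMean (fun x : D → S => ∑ X, h K X (x X)) (Measure.pi (κA K)) 0| ≤ w K)
    (hY : YoungInfluenceRate (ι := Unit) l₀ (fun _ => {()}) (fun _ _ => ∅) (fun _ _ => univ) sc
      (fun K _ _ s X => tiltedMean (h K X) (κA K X) s - tiltedMean (h K X) (κA K X) 0)
      (fun K _ _ s X => tiltedMean (h K X) (κB K X) s - tiltedMean (h K X) (κB K X) 0) vol C θ Λ')
    (hvol : 0 ≤ vol) (hθ₁ : 0 ≤ θ₁ ^ 2 * Λ) (hθ : 0 ≤ θ) (hΛ' : 0 ≤ Λ') :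
    TiltedMeanMatching (ι := Unit) (Ω := fun _ => D → S) (Ω' := fun _ => D → S) l₀ (fun _ => {()}) (fun _ _ => ∅)
      (fun K x => ∑ X, h K X (x X)) (fun K _ => Measure.pi (κA K))
      (fun K x => ∑ X, h K X (x X)) (fun K _ => Measure.pi (κB K))
      (crossoverEta vol (l₀ * c₁ ^ 2) (l₀ * c₁ ^ 2) C (θ₁ ^ 2 * Λ) θ Λ' w) :=
  tiltedMeanMatching_of_budget (scaleLedger_pi_increments hmeas hbound hsc hw)
    (oldInfluenceBudget_of_increments (T := fun _ => {()}) (Bad := fun _ _ => ∅) (wf := fun _ _ => univ)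
      hmeas hbound hamp fun K _ => hcount K)
    (oldInfluenceBudget_of_increments (T := fun _ => {()}) (Bad := fun _ _ => ∅) (wf := fun _ _ => univ)
      hmeas hbound hamp fun K _ => hcount K)
    hY hvol hθ₁ hθ hΛ'

omit [Fintype D] [DecidableEq D] [MeasurableSpace S] [∀ K X, IsProbabilityMeasure (κA K X)]
  [∀ K X, IsProbabilityMeasure (κB K X)] in
/-- … and the majorant is SUMMABLE when the zero-tilt matching is (`Summable w`) and the letters are in the open unit interval
(`0 < θ₁²Λ < 1`, `0 < θ < 1`, `θ ≤ Λ′`; gen 3's `summable_crossoverEta`). [folklore] -/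
theorem summable_crossoverEta_of_zeroTilt {vol c₁ θ₁ Λ C θ Λ' : ℝ} (h0 : 0 < θ₁ ^ 2 * Λ) (h1 : θ₁ ^ 2 * Λ < 1)
    (hθ : 0 < θ) (hθ1 : θ < 1) (hθΛ : θ ≤ Λ') (hws : Summable w) :
    Summable (crossoverEta vol (l₀ * c₁ ^ 2) (l₀ * c₁ ^ 2) C (θ₁ ^ 2 * Λ) θ Λ' w) :=
  summable_crossoverEta h0 h1 hθ hθ1 hθΛ hws

end Model

end YMDAG.N14.TiltIncrement

end
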